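import Literature.GroupTheory.CombinatorialGroupTheory.QuadraticWordsVertexCalculus
import Literature.GroupTheory.CombinatorialGroupTheory.RibbonBoundaryOneFace
import HarnessLib

/-!
# The boundary system of the punctured surface `S_{g,r+1}` in the free basis of `Γ_{g,r+1}`

Topic `Literature/GroupTheory/CombinatorialGroupTheory`.  In the free basis
`X = (Fin g × Bool) ⊕ Fin r` of `Γ_{g,r+1}` (`aᵢ, bᵢ, c₂, …, c_{r+1}`; `c₁ = A⁻¹B⁻¹`, `A = ∏[aᵢ,bᵢ]`,
`B = c₂⋯c_{r+1}`, `PuncturedSurfaceGroupFree.lean`) the `r + 1` boundary curves of the surface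
`S_{g,r+1}` are, as cyclic words over `X × Bool`, the "downstairs face system"

  `baseSystem g r r = [ a₁⁺b₁⁺a₁⁻b₁⁻ ⋯ a_g⁺b_g⁺a_g⁻b_g⁻ c₂⁺ ⋯ c_{r+1}⁺ , [c₂⁻], …, [c_{r+1}⁻] ]`

(the first face reads `A·B`, a conjugate of `c₁⁻¹`; the others the petals `c_j⁻¹`; ZVC 3.1.8 / §4.14:
the fundamental polygon of a bounded surface).  We prove that it is a one-vertex face system in the
sense of `QuadraticSystems.lean`: pairwise distinct letters (`nodup_baseSystem`), every letter of
`X × Bool` occurs (`mem_baseSystem`), no empty face (`ne_nil_of_mem_baseSystem`), and the vertex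
permutation `sysPerm` is TRANSITIVE (`sameCycle_sysPerm_baseSystem`) — by induction on the number of
petals, adding one petal at a time (`sysPerm_appendPetal_transitive` of seat abc-iut-w5-d186, here an in-file
private copy `appendPetal_transitive_aux` while that module awaits its farm build) to the
closed surface word, which is one-vertex by `vertexTransitive_surfaceWordStd` (seat abc-iut-L5-d3).
Also the free-group values of the faces (`mk_baseWord`, `mk_baseSystem_get`: face `0` is
`A·(A⁻¹B⁻¹)⁻¹·A⁻¹`, face `j+1` is `(c_{j+2})⁻¹`).  This is the base ("downstairs") datum of the
covering computation of finite-index subgroups of `Γ_{g,r+1}` (Hoare–Karrass–Solitar; BRICK 2a of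
the cell's GT-A plan).  Definitions + theorems.

## References

* H. Zieschang, E. Vogt, H.-D. Coldewey, *Surfaces and Planar Discontinuous Groups*, LNM 835,
  Springer 1980, 3.1.8, §4.14. [ZieschangVogtColdewey1980]
-/

namespace Literature.GroupTheory.CombinatorialGroupTheory.PuncturedSurfaceGroup

open List Equiv Equiv.Perm Function

variable (g r : ℕ)

/-- The relabelling of a letter of the closed surface word into the alphabet
`X = (Fin g × Bool) ⊕ Fin r`. [cite: ZieschangVogtColdewey1980, 3.1.8] -/
def handleLetter : (Fin g × Bool) × Bool → ((Fin g × Bool) ⊕ Fin r) × Bool := fun x => (Sum.inl x.1, x.2)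

/-- The handle part `a₁⁺b₁⁺a₁⁻b₁⁻ ⋯ a_g⁺b_g⁺a_g⁻b_g⁻` of the big boundary word (the closed surface word,
relabelled). [cite: ZieschangVogtColdewey1980, 3.1.8] -/
def handleWord : List (((Fin g × Bool) ⊕ Fin r) × Bool) := (surfaceWordStd g).map (handleLetter g r)

/-- The first `k` puncture letters `c₂⁺ ⋯ c_{k+1}⁺` (as `inr 0, …, inr (k-1)`).
[cite: ZieschangVogtColdewey1980, 3.1.8] -/
def cuspPlus (k : ℕ) : List (((Fin g × Bool) ⊕ Fin r) × Bool) :=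
  ((List.finRange r).take k).map fun j => (Sum.inr j, true)

/-- The first `k` petal faces `[c_{j+2}⁻]`, `j < k`. [cite: ZieschangVogtColdewey1980, 3.1.8] -/
def cuspFaces (k : ℕ) : List (List (((Fin g × Bool) ⊕ Fin r) × Bool)) :=
  ((List.finRange r).take k).map fun j => [(Sum.inr j, false)]

/-- The big boundary word with the first `k` punctures: `(handles) c₂⁺ ⋯ c_{k+1}⁺`.
[cite: ZieschangVogtColdewey1980, 3.1.8] -/
def baseWord (k : ℕ) : List (((Fin g × Bool) ⊕ Fin r) × Bool) := handleWord g r ++ cuspPlus g r k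

/-- **The downstairs face system** with the first `k` punctures: the big boundary word and the `k`
petals (`k = r` is the boundary system of `S_{g,r+1}`). [cite: ZieschangVogtColdewey1980, 3.1.8] -/
def baseSystem (k : ℕ) : List (List (((Fin g × Bool) ⊕ Fin r) × Bool)) := baseWord g r k :: cuspFaces g r k

/-- `A = ∏ᵢ [aᵢ, bᵢ]` in the free group on `X`. [cite: ZieschangVogtColdewey1980, 3.1.8] -/
def handleProd : FreeGroup ((Fin g × Bool) ⊕ Fin r) :=
  ((List.finRange g).map fun i =>
    FreeGroup.of (Sum.inl (i, false)) * FreeGroup.of (Sum.inl (i, true)) *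
      (FreeGroup.of (Sum.inl (i, false)))⁻¹ * (FreeGroup.of (Sum.inl (i, true)))⁻¹).prod

/-- `B = c₂ ⋯ c_{r+1}` in the free group on `X`. [cite: ZieschangVogtColdewey1980, 3.1.8] -/
def petalProd : FreeGroup ((Fin g × Bool) ⊕ Fin r) :=
  ((List.finRange r).map fun j => FreeGroup.of (Sum.inr j)).prod

/-- The free-group elements representing the cusps `c₁, …, c_{r+1}` in the basis `X`:
`c₁ ↦ A⁻¹B⁻¹`, `c_{j+2} ↦ inr j`. [cite: ZieschangVogtColdewey1980, 3.1.8] -/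
def cuspElt : Fin (r + 1) → FreeGroup ((Fin g × Bool) ⊕ Fin r) :=
  Fin.cases ((handleProd g r)⁻¹ * (petalProd g r)⁻¹) fun j => FreeGroup.of (Sum.inr j)

variable {g r}

/-- `handleLetter` is injective. [cite: ZieschangVogtColdewey1980, 3.1.8] -/
theorem handleLetter_injective : Injective (handleLetter g r) := fun x y h => by
  simp only [handleLetter, Prod.mk.injEq, Sum.inl.injEq] at h
  exact Prod.ext h.1 h.2

/-- `handleLetter` commutes with `bar`. [cite: ZieschangVogtColdewey1980, 3.1.8] -/
theorem handleLetter_bar (x : (Fin g × Bool) × Bool) : handleLetter g r (bar x) = bar (handleLetter g r x) := rfl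

/-- Membership in the handle word. [cite: ZieschangVogtColdewey1980, 3.1.8] -/
theorem mem_handleWord_iff (x : ((Fin g × Bool) ⊕ Fin r) × Bool) :
    x ∈ handleWord g r ↔ ∃ y : Fin g × Bool, x.1 = Sum.inl y := by
  constructor
  · intro hx
    obtain ⟨y, -, rfl⟩ := mem_map.1 hx
    exact ⟨y.1, rfl⟩
  · rintro ⟨y, hy⟩
    obtain ⟨x1, x2⟩ := x
    simp only at hy
    subst hy
    exact mem_map.2 ⟨(y, x2), mem_surfaceWordStd _, rfl⟩

/-- Membership in `take k (finRange r)`. [cite: ZieschangVogtColdewey1980, 3.1.8] -/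
theorem mem_take_finRange_iff {k : ℕ} (j : Fin r) :
    j ∈ (List.finRange r).take k ↔ j.val < k := by
  rw [mem_take_iff_getElem]
  constructor
  · rintro ⟨i, hi, e⟩
    rw [getElem_finRange] at e
    rw [← e]
    simp only [Fin.cast_mk]
    rw [length_finRange] at hi
    omega
  · intro hj
    refine ⟨j.val, by rw [length_finRange]; omega, ?_⟩
    rw [getElem_finRange]
    simp

/-- Membership in the puncture letters. [cite: ZieschangVogtColdewey1980, 3.1.8] -/
theorem mem_cuspPlus_iff {k : ℕ} (x : ((Fin g × Bool) ⊕ Fin r) × Bool) :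
    x ∈ cuspPlus g r k ↔ ∃ j : Fin r, j.val < k ∧ x = (Sum.inr j, true) := by
  simp only [cuspPlus, mem_map, mem_take_finRange_iff]
  exact ⟨fun ⟨j, hj, e⟩ => ⟨j, hj, e.symm⟩, fun ⟨j, hj, e⟩ => ⟨j, hj, e.symm⟩⟩

/-- Membership in the petal faces. [cite: ZieschangVogtColdewey1980, 3.1.8] -/
theorem mem_cuspFaces_flatten_iff {k : ℕ} (x : ((Fin g × Bool) ⊕ Fin r) × Bool) :
    x ∈ (cuspFaces g r k).flatten ↔ ∃ j : Fin r, j.val < k ∧ x = (Sum.inr j, false) := by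
  simp only [cuspFaces, mem_flatten, mem_map, mem_take_finRange_iff]
  constructor
  · rintro ⟨l, ⟨⟨j, hj, rfl⟩, hx⟩⟩
    rw [mem_singleton] at hx
    exact ⟨j, hj, hx⟩
  · rintro ⟨j, hj, rfl⟩
    exact ⟨[(Sum.inr j, false)], ⟨j, hj, rfl⟩, by simp⟩

/-- **Membership in the downstairs system**: the handle letters and the `±`-letters of the first `k`
punctures. [cite: ZieschangVogtColdewey1980, 3.1.8] -/
theorem mem_baseSystem_flatten_iff {k : ℕ} (x : ((Fin g × Bool) ⊕ Fin r) × Bool) :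
    x ∈ (baseSystem g r k).flatten ↔
      (∃ y : Fin g × Bool, x.1 = Sum.inl y) ∨ ∃ j : Fin r, j.val < k ∧ x.1 = Sum.inr j := by
  rw [baseSystem, flatten_cons, mem_append, baseWord, mem_append, mem_handleWord_iff, mem_cuspPlus_iff,
    mem_cuspFaces_flatten_iff]
  constructor
  · rintro ((h | ⟨j, hj, rfl⟩) | ⟨j, hj, rfl⟩)
    · exact Or.inl h
    · exact Or.inr ⟨j, hj, rfl⟩
    · exact Or.inr ⟨j, hj, rfl⟩
  · rintro (h | ⟨j, hj, e⟩)
    · exact Or.inl (Or.inl h)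
    · obtain ⟨x1, _ | _⟩ := x
      · simp only at e; subst e; exact Or.inr ⟨j, hj, rfl⟩
      · simp only at e; subst e; exact Or.inl (Or.inr ⟨j, hj, rfl⟩)

/-- **Every letter occurs in the full downstairs system** (`k = r`). [cite: ZieschangVogtColdewey1980, 3.1.8] -/
theorem mem_baseSystem (x : ((Fin g × Bool) ⊕ Fin r) × Bool) : x ∈ (baseSystem g r r).flatten := by
  rw [mem_baseSystem_flatten_iff]
  obtain ⟨y | j, s⟩ := x
  · exact Or.inl ⟨y, rfl⟩
  · exact Or.inr ⟨j, j.2, rfl⟩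

/-- The downstairs system is closed under partners. [cite: ZieschangVogtColdewey1980, 3.1.8] -/
theorem bar_mem_baseSystem {k : ℕ} {x : ((Fin g × Bool) ⊕ Fin r) × Bool}
    (hx : x ∈ (baseSystem g r k).flatten) : bar x ∈ (baseSystem g r k).flatten := by
  rw [mem_baseSystem_flatten_iff] at hx ⊢
  exact hx

/-- Flattening singleton faces. [cite: ZieschangVogtColdewey1980, 3.1.1] -/
theorem flatten_map_singleton' {α β : Type*} (l : List α) (f : α → β) :
    (l.map fun x => [f x]).flatten = l.map f := by
  induction l with
  | nil => rfl
  | cons a l ih => rw [map_cons, flatten_cons, ih, map_cons, singleton_append]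

/-- **The letters of the downstairs system are pairwise distinct.** [cite: ZieschangVogtColdewey1980, 3.1.8] -/
theorem nodup_baseSystem (k : ℕ) : (baseSystem g r k).flatten.Nodup := by
  have hdF : ((List.finRange r).take k).Nodup := (nodup_finRange r).sublist (take_sublist _ _)
  have h1 : (handleWord g r).Nodup := (nodup_surfaceWordStd g).map handleLetter_injective
  have h2 : (cuspPlus g r k).Nodup := hdF.map fun j j' h => by simpa using h
  have h3 : (cuspFaces g r k).flatten.Nodup := by
    rw [cuspFaces, flatten_map_singleton']
    exact hdF.map fun j j' h => by simpa using h
  rw [baseSystem, flatten_cons, nodup_append, baseWord, nodup_append]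
  refine ⟨⟨h1, h2, fun x hx y hy hxy => ?_⟩, h3, fun x hx y hy hxy => ?_⟩
  · subst hxy
    obtain ⟨z, hz⟩ := (mem_handleWord_iff x).1 hx
    obtain ⟨j, -, rfl⟩ := (mem_cuspPlus_iff _).1 hy
    simp at hz
  · subst hxy
    obtain ⟨j, -, rfl⟩ := (mem_cuspFaces_flatten_iff _).1 hy
    rcases mem_append.1 hx with hx | hx
    · obtain ⟨z, hz⟩ := (mem_handleWord_iff _).1 hx
      simp at hz
    · obtain ⟨j', -, e⟩ := (mem_cuspPlus_iff _).1 hx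
      simp at e

/-- `take (k+1)` of `finRange r` for `k < r`. [cite: ZieschangVogtColdewey1980, 3.1.1] -/
theorem take_finRange_succ {k : ℕ} (hk : k < r) :
    (List.finRange r).take (k + 1) = (List.finRange r).take k ++ [⟨k, hk⟩] := by
  rw [take_add_one, getElem?_eq_getElem (by rw [length_finRange]; exact hk), getElem_finRange]
  rfl

/-- `baseSystem (k+1)` is, up to the order of its faces, `(baseWord k ++ [c⁺]) :: [c⁻] :: cuspFaces k` —
adding a petal. [cite: ZieschangVogtColdewey1980, 3.1.8] -/
theorem baseSystem_succ_perm {k : ℕ} (hk : k < r) :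
    baseSystem g r (k + 1) ~
      (baseWord g r k ++ [bar ((Sum.inr ⟨k, hk⟩, false) : ((Fin g × Bool) ⊕ Fin r) × Bool)]) ::
        [((Sum.inr ⟨k, hk⟩, false) : ((Fin g × Bool) ⊕ Fin r) × Bool)] :: cuspFaces g r k := by
  have e1 : baseWord g r (k + 1) =
      baseWord g r k ++ [bar ((Sum.inr ⟨k, hk⟩, false) : ((Fin g × Bool) ⊕ Fin r) × Bool)] := by
    rw [baseWord, baseWord, cuspPlus, cuspPlus, take_finRange_succ hk, map_append, map_singleton, append_assoc]
    rfl
  have e2 : cuspFaces g r (k + 1) =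
      cuspFaces g r k ++ [[((Sum.inr ⟨k, hk⟩, false) : ((Fin g × Bool) ⊕ Fin r) × Bool)]] := by
    rw [cuspFaces, cuspFaces, take_finRange_succ hk, map_append, map_singleton]
  rw [baseSystem, e1, e2]
  exact Perm.cons _ perm_append_comm

/-- Appending a petal to a one-vertex system keeps one vertex (in-file copy of
`sysPerm_appendPetal_transitive`, seat abc-iut-w5-d186, `PeripheralPetalMoves.lean` p415002, whose
module is not yet built on the farm; to be deduplicated by importing that file once it builds).
[cite: ZieschangVogtColdewey1980, 3.2.4] -/
private theorem appendPetal_transitive_aux {ι : Type*} [DecidableEq ι] [Fintype ι] {A : List (ι × Bool)} {Gs : List (List (ι × Bool))}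
    {x : ι × Bool} (hA : A ≠ []) (hd : ((A ++ [bar x]) :: [x] :: Gs).flatten.Nodup)
    (hlast : bar (A.getLast hA) ∈ (A :: Gs).flatten)
    (h : ∀ y ∈ (A :: Gs).flatten, ∀ z ∈ (A :: Gs).flatten, (sysPerm (A :: Gs)).SameCycle y z) :
    ∀ y ∈ ((A ++ [bar x]) :: [x] :: Gs).flatten, ∀ z ∈ ((A ++ [bar x]) :: [x] :: Gs).flatten,
      (sysPerm ((A ++ [bar x]) :: [x] :: Gs)).SameCycle y z := by
  classical
  -- letters
  have hx : x ∉ (A :: Gs).flatten := by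
    intro hx'
    simp only [flatten_cons, mem_append] at hx'
    have hnd := hd
    simp only [flatten_cons] at hnd
    rcases hx' with hx' | hx'
    · exact (disjoint_of_nodup_append hnd) (mem_append_left _ hx') (mem_append_left _ (mem_singleton_self x))
    · have h2 := (nodup_append.1 hnd).2.1
      exact (disjoint_of_nodup_append h2) (mem_singleton_self x) hx'
  have hx' : bar x ∉ (A :: Gs).flatten := by
    intro hx''
    simp only [flatten_cons, mem_append] at hx''
    have hnd := hd
    simp only [flatten_cons] at hnd
    rcases hx'' with h1 | h1
    · have h2 := (nodup_append.1 hnd).1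
      exact (disjoint_of_nodup_append h2) h1 (mem_singleton_self _)
    · exact (disjoint_of_nodup_append hnd) (mem_append_right _ (mem_singleton_self _))
        (mem_append_right _ h1)
  -- the vertex permutations
  have hd₁ : (A :: [bar x] :: [x] :: Gs).flatten.Nodup := by simpa [flatten_cons] using hd
  set σ := sysPerm (A :: Gs) with hσ
  have hmid : sysPerm (A :: [bar x] :: [x] :: Gs) = σ := by
    simp [hσ, sysPerm, formPerm_singleton]
  have hnew : sysPerm ((A ++ [bar x]) :: [x] :: Gs) = σ * swap (bar (A.getLast hA)) x := by
    rw [sysPerm_append_cons (Gs := [x] :: Gs) hd₁ hA (cons_ne_nil _ _), hmid]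
    simp
  -- `σ` on the fresh letters: a 2-cycle
  have hσx : σ x = bar x := by
    rw [hσ, sysPerm_apply, prod_formPerm_apply_of_not_mem hx']
  have hσx' : σ (bar x) = x := by
    rw [hσ, sysPerm_apply, bar_bar, prod_formPerm_apply_of_not_mem hx]
  -- the `σ`-cycle of `x` is `{x, x̄}`, which misses `ā`
  have hcyc : ∀ y, σ.SameCycle x y → y = x ∨ y = bar x := by
    intro y hy
    have hT : ∀ z ∈ ({x, bar x} : Set (ι × Bool)), σ z ∈ ({x, bar x} : Set (ι × Bool)) := by
      intro z hz
      rcases hz with rfl | hz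
      · rw [hσx]; exact Or.inr rfl
      · rw [Set.mem_singleton_iff] at hz; subst hz; rw [hσx']; exact Or.inl rfl
    exact SameCycle.mem_of_forall_apply_mem hT (Or.inl rfl) hy
  have haA : A.getLast hA ∈ A := getLast_mem hA
  have hnot : ¬ σ.SameCycle (bar (A.getLast hA)) x := by
    intro hs
    rcases hcyc _ hs.symm with e | e
    · -- `x = ā`, i.e. `x̄ = a ∈ A`: impossible
      have : bar x ∈ (A :: Gs).flatten := by
        rw [flatten_cons]; refine mem_append_left _ ?_
        rw [← e, bar_bar]; exact haA
      exact hx' this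
    · -- `x̄ = ā`, i.e. `x = a ∈ A`
      have : x ∈ (A :: Gs).flatten := by
        rw [flatten_cons]; refine mem_append_left _ ?_
        rw [← bar_injective e]; exact haA
      exact hx this
  -- merge
  set u := bar (A.getLast hA) with hu
  have hτu : (σ * swap u x) u = σ x := by rw [Perm.mul_apply, swap_apply_left]
  have hτx : (σ * swap u x) x = σ u := by rw [Perm.mul_apply, swap_apply_right]
  have hτ : ∀ z, z ≠ u → z ≠ x → (σ * swap u x) z = σ z := fun z h1 h2 => by
    rw [Perm.mul_apply, swap_apply_of_ne_of_ne h1 h2]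
  have merge : ∀ y, y ∈ ((A ++ [bar x]) :: [x] :: Gs).flatten → (σ * swap u x).SameCycle u y := by
    intro y hy
    refine sameCycle_of_swap_merge hτu hτx hτ hnot ?_
    have hy' : y ∈ (A :: Gs).flatten ∨ y = bar x ∨ y = x := by
      simp only [flatten_cons, mem_append, mem_singleton] at hy ⊢
      tauto
    rcases hy' with hy' | rfl | rfl
    · exact Or.inl (h u hlast y hy')
    · exact Or.inr ⟨1, by rw [zpow_one, hσx]⟩
    · exact Or.inr SameCycle.rfl
  intro y hy z hz
  rw [hnew]
  exact (merge y hy).symm.trans (merge z hz)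

/-- **The downstairs system has one vertex**: its vertex permutation is transitive on its letters
(closed surface word: `vertexTransitive_surfaceWordStd`; each petal: `sysPerm_appendPetal_transitive`).
[cite: ZieschangVogtColdewey1980, 3.1.8] -/
theorem sameCycle_sysPerm_baseSystem :
    ∀ {k : ℕ}, k ≤ r → ∀ x ∈ (baseSystem g r k).flatten, ∀ z ∈ (baseSystem g r k).flatten,
      (sysPerm (baseSystem g r k)).SameCycle x z
  | 0, _ => by
    -- the closed surface word, relabelled
    have e0 : baseSystem g r 0 = [handleWord g r] := by
      simp [baseSystem, baseWord, cuspPlus, cuspFaces]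
    rw [e0]
    intro x hx z hz
    rw [flatten_singleton] at hx hz
    rw [sysPerm_singleton]
    obtain ⟨x', -, rfl⟩ := mem_map.1 hx
    obtain ⟨z', -, rfl⟩ := mem_map.1 hz
    obtain ⟨n, hn⟩ := (vertexTransitive_surfaceWordStd g x' (mem_surfaceWordStd _) z'
      (mem_surfaceWordStd _)).exists_nat_pow_eq
    refine ⟨n, ?_⟩
    rw [zpow_natCast, handleWord, vertexPerm_map_pow_apply handleLetter_injective handleLetter_bar
      (nodup_surfaceWordStd g), hn]
  | k + 1, hk => by
    classical
    have hk' : k < r := hk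
    set x : ((Fin g × Bool) ⊕ Fin r) × Bool := (Sum.inr ⟨k, hk'⟩, false) with hxdef
    have ih := sameCycle_sysPerm_baseSystem (k := k) hk'.le
    have hperm := baseSystem_succ_perm (g := g) hk'
    have hd0 : (baseSystem g r (k + 1)).flatten.Nodup := nodup_baseSystem (k + 1)
    have hd : ((baseWord g r k ++ [bar x]) :: [x] :: cuspFaces g r k).flatten.Nodup :=
      hperm.flatten.nodup_iff.1 hd0
    -- transfer along the permutation of faces
    suffices H : ∀ y ∈ ((baseWord g r k ++ [bar x]) :: [x] :: cuspFaces g r k).flatten,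
        ∀ z ∈ ((baseWord g r k ++ [bar x]) :: [x] :: cuspFaces g r k).flatten,
        (sysPerm ((baseWord g r k ++ [bar x]) :: [x] :: cuspFaces g r k)).SameCycle y z by
      intro y hy z hz
      rw [sysPerm_eq_of_perm hd0 hperm]
      exact H y (hperm.flatten.mem_iff.1 hy) z (hperm.flatten.mem_iff.1 hz)
    by_cases hA : baseWord g r k = []
    · -- no handles and no earlier puncture: the annulus `[[c⁺], [c⁻]]`
      have hGs : cuspFaces g r k = [] := by
        have : cuspPlus g r k = [] := by rw [baseWord] at hA; exact (append_eq_nil_iff.1 hA).2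
        rw [cuspPlus, map_eq_nil_iff] at this
        rw [cuspFaces, this]; rfl
      rw [hA, hGs, nil_append]
      intro y hy z hz
      have hd2 : ([[bar x], [x]] : List (List _)).flatten.Nodup := by simpa [hA, hGs] using hd
      have hσ2 : sysPerm [[bar x], [x]] x = bar x := by
        rw [sysPerm_apply_of_bar_mem hd2 (F := [bar x]) (by simp) (by simp)]; simp
      have key : ∀ w ∈ ([[bar x], [x]] : List (List _)).flatten, (sysPerm [[bar x], [x]]).SameCycle x w := by
        intro w hw
        simp only [flatten_cons, flatten_nil, append_nil, singleton_append, mem_cons, not_mem_nil,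
          or_false] at hw
        rcases hw with rfl | rfl
        · exact ⟨1, by rw [zpow_one, hσ2]⟩
        · exact SameCycle.rfl
      exact (key y hy).symm.trans (key z hz)
    · exact appendPetal_transitive_aux hA hd
        (bar_mem_baseSystem (mem_flatten.2 ⟨baseWord g r k, by simp [baseSystem], getLast_mem hA⟩)) ih

/-! ### The faces and their free-group values -/

/-- The number of faces: `k + 1` (for `k ≤ r`). [cite: ZieschangVogtColdewey1980, 3.1.8] -/
theorem length_baseSystem {k : ℕ} (hk : k ≤ r) : (baseSystem g r k).length = k + 1 := by
  simp [baseSystem, cuspFaces, length_take, length_finRange, Nat.min_eq_left hk]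

/-- Face `0` is the big boundary word. [cite: ZieschangVogtColdewey1980, 3.1.8] -/
theorem baseSystem_getElem_zero {k : ℕ} (h : 0 < (baseSystem g r k).length) :
    (baseSystem g r k)[0] = baseWord g r k := rfl

/-- Face `j + 1` is the petal `[c_{j+2}⁻]`. [cite: ZieschangVogtColdewey1980, 3.1.8] -/
theorem baseSystem_getElem_succ {j : ℕ} (h : j + 1 < (baseSystem g r r).length) :
    (baseSystem g r r)[j + 1] = [((Sum.inr ⟨j, by
      have := length_baseSystem (g := g) (r := r) le_rfl; omega⟩ : (Fin g × Bool) ⊕ Fin r), false)] := by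
  have hj : j < r := by have := length_baseSystem (g := g) (r := r) le_rfl; omega
  simp only [baseSystem, getElem_cons_succ, cuspFaces, getElem_map]
  congr 2
  rw [getElem_take, getElem_finRange]
  rfl

/-- The faces of the full downstairs system: the big word and the `r` petals. [cite: ZieschangVogtColdewey1980, 3.1.8] -/
theorem mem_baseSystem_iff (W : List (((Fin g × Bool) ⊕ Fin r) × Bool)) :
    W ∈ baseSystem g r r ↔ W = baseWord g r r ∨ ∃ j : Fin r, W = [(Sum.inr j, false)] := by
  rw [baseSystem, mem_cons, cuspFaces, mem_map, take_of_length_le (by simp)]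
  simp only [mem_finRange, true_and]
  exact ⟨fun h => h.imp_right fun ⟨j, e⟩ => ⟨j, e.symm⟩, fun h => h.imp_right fun ⟨j, e⟩ => ⟨j, e.symm⟩⟩

/-- No face of the downstairs system is empty when `(g, r) ≠ (0, 0)`, e.g. for a hyperbolic type
`(g, r+1)`. [cite: ZieschangVogtColdewey1980, 3.1.8] -/
theorem ne_nil_of_mem_baseSystem (h : 0 < g ∨ 0 < r) {W : List (((Fin g × Bool) ⊕ Fin r) × Bool)}
    (hW : W ∈ baseSystem g r r) : W ≠ [] := by
  rcases (mem_baseSystem_iff W).1 hW with rfl | ⟨j, rfl⟩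
  · rw [baseWord, handleWord, cuspPlus, take_of_length_le (by simp)]
    rcases h with hg | hr
    · have : (surfaceWordStd g).length ≠ 0 := by rw [length_surfaceWordStd]; omega
      intro e
      exact this (by rw [append_eq_nil_iff, map_eq_nil_iff] at e; rw [e.1]; rfl)
    · intro e
      rw [append_eq_nil_iff] at e
      have : ((List.finRange r).map fun j => ((Sum.inr j : (Fin g × Bool) ⊕ Fin r), true)).length = 0 := by
        rw [e.2]; rfl
      rw [length_map, length_finRange] at this
      omega
  · exact cons_ne_nil _ _

/-- `mk` of a concatenation of words is the product of the `mk`s. [cite: ZieschangVogtColdewey1980, 3.1.1] -/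
theorem mk_flatten_map {α β : Type*} (l : List α) (f : α → List (β × Bool)) :
    FreeGroup.mk ((l.map f).flatten) = (l.map fun x => FreeGroup.mk (f x)).prod := by
  induction l with
  | nil => rfl
  | cons a l ih => rw [map_cons, flatten_cons, ← FreeGroup.mul_mk, ih, map_cons, prod_cons]

/-- **The free-group value of the handle word**: `A = ∏ᵢ [aᵢ, bᵢ]`. [cite: ZieschangVogtColdewey1980, 3.1.8] -/
theorem mk_handleWord : FreeGroup.mk (handleWord g r) = handleProd g r := by
  rw [handleWord, surfaceWordStd, map_flatMap, flatMap_def, mk_flatten_map, handleProd]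
  congr 1

/-- **The free-group value of the puncture letters**: `B = c₂ ⋯ c_{r+1}`. [cite: ZieschangVogtColdewey1980, 3.1.8] -/
theorem mk_cuspPlus : FreeGroup.mk (cuspPlus g r r) = petalProd g r := by
  rw [cuspPlus, take_of_length_le (by simp), petalProd]
  induction (List.finRange r) with
  | nil => rfl
  | cons j l ihl =>
    rw [map_cons, map_cons, prod_cons, ← ihl, ← singleton_append, ← FreeGroup.mul_mk]
    rfl

/-- **The free-group value of the big face**: `mk (baseWord g r r) = A · B`.
[cite: ZieschangVogtColdewey1980, 3.1.8] -/
theorem mk_baseWord : FreeGroup.mk (baseWord g r r) = handleProd g r * petalProd g r := by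
  rw [baseWord, ← FreeGroup.mul_mk, mk_handleWord, mk_cuspPlus]

/-- **The downstairs cusp dictionary**: face `f` of the boundary system reads a conjugate of the
INVERSE of the cusp element `cuspElt f` (`f = 0`: `A·B = A·(A⁻¹B⁻¹)⁻¹·A⁻¹`; `f = j+1`:
`c_{j+2}⁻ = (c_{j+2})⁻¹`). [cite: ZieschangVogtColdewey1980, 3.1.8] -/
theorem mk_baseSystem_get (f : Fin (baseSystem g r r).length) :
    ∃ w : FreeGroup ((Fin g × Bool) ⊕ Fin r),
      FreeGroup.mk ((baseSystem g r r).get f) =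
        w * (cuspElt g r (Fin.cast (length_baseSystem le_rfl) f))⁻¹ * w⁻¹ := by
  obtain ⟨f, hf⟩ := f
  cases f with
  | zero =>
    refine ⟨handleProd g r, ?_⟩
    rw [get_eq_getElem, baseSystem_getElem_zero, mk_baseWord]
    change _ = handleProd g r * (cuspElt g r 0)⁻¹ * (handleProd g r)⁻¹
    rw [cuspElt, Fin.cases_zero]
    group
  | succ j =>
    refine ⟨1, ?_⟩
    rw [get_eq_getElem, baseSystem_getElem_succ, one_mul, inv_one, mul_one]
    have hj : j < r := by have := length_baseSystem (g := g) (r := r) le_rfl; omega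
    have e : (Fin.cast (length_baseSystem (g := g) (r := r) le_rfl) ⟨j + 1, hf⟩ : Fin (r + 1)) =
        Fin.succ ⟨j, hj⟩ := Fin.ext rfl
    rw [e, cuspElt, Fin.cases_succ]
    rfl

end Literature.GroupTheory.CombinatorialGroupTheory.PuncturedSurfaceGroup
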